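import Literature.NumberTheory.NumberFields.QuadraticSqrtTwoClassNumberNotDvdFour
import HarnessLib

/-!
# An ORDER-FOUR CERTIFICATE for `4 ∣ h(K(√2))`: three units of `L = K(√2)` independent modulo `±` squares (by residue
# symbols COMPUTED IN `𝓞_K`), Dirichlet's bound `rank E_L ≤ 3`, and an explicit ideal `𝔅 = (b, v)` with `𝔅² = (w, b²)` NOT principal,
# `𝔅⁴ = (w)` — hence a class of order `4` and `2 ≤ ord₂ h_L`

Topic `NumberTheory/NumberFields` (namespace = path).  THEOREM-ONLY file (no definition, no named fact, no instance, no `sorry`),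
written by the prover seat `bsd-line-att-p4` g40 (cell `bsd-f1-sign2`, route `AlignedTransportAtTwo`; `--supports`
stmt-BirchSwinnertonDyer-22298, closes nothing).  It is the COMPLEMENT of att-p3 g43's genus-character certificate
(`QuadraticSqrtTwoClassNumberNotDvdFour`: `ord₂ h(K(√2)) = 1`): here the conclusion is `4 ∣ h(K(√2))`, i.e. `ord₂ h ≥ 2`, the per-seed input
«`e₁ ≥ 2`» of att-p3 g46's pro-cyclic door for the cyclotomic `ℤ₂`-tower of a cubic field — the NON-PRINCIPALITY in the sextic field `K(√2)`
that the cell had only census-grade (python) so far, now decided by identities and residue maps of the BASE ring `𝓞_K`.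

## The statement (`four_dvd_card_classGroup_of_orderFourCert`, `two_le_padicValNat_card_classGroup_of_orderFourCert`)

`K ⊆ L` number fields, `L/K` Galois of degree `2`, `s ∈ L` with `s² = 2`, `s ∉ K`; `K` has a real place and at most two infinite places (e.g. a
complex cubic field; then `√−1 ∉ L` and `rank E_L ≤ 3`).  DATA: units `u₁, u₂, u₃ ∈ 𝓞_Lˣ` and `w ∈ 𝓞_L` with displayed coordinates
`u_i = a_i + b_i s`, `w = A + B s` (`a_i, b_i, A, B ∈ 𝓞_K`); `b ≠ 0`, `v ∈ 𝓞_L` with the ideal identities `(b, v)² = (w, b²)` and `(w, b²)² = (w)`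
(§5 derives both from ring witnesses); and, for each of the `31` sign/exponent patterns `(e₁,e₂,e₃,e₄,±) ≠ (0,0,0,0,+)`, `e_i ∈ {0,1}`, a RESIDUE
CERTIFICATE: a ring map `ψ : 𝓞_K → ℤ/q` with `2` invertible and `ρ ∈ 𝓞_K` with `ψ(ρ)² = 2` such that `±∏(ψa_i + ψb_i·ψρ)^{e_i}·(ψA + ψB·ψρ)^{e₄}`
is not a square in `ℤ/q`.  THEN `4 ∣ #Cl(𝓞_L)` and `2 ≤ ord₂ #Cl(𝓞_L)`.

## Proof (elementary: Dirichlet's unit theorem, ideal arithmetic, reduction maps — no class field theory)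

* §1 coordinates in `L = K ⊕ Ks` (uniqueness, products; `−1` is not a square in `L` if `K` is real somewhere: `a² + 2c² = −1`).
* §2 `z ∈ 𝓞_L ⟹ 4z ∈ 𝓞_K + 𝓞_K s` (`2a = Tr z`, `(4c)² = 2·(z − σz)²`; the conductor of `𝓞_K[√2]` divides `4`).
* §3 ★ the residue-symbol obstruction: `z² = A + Bs` ⟹ `16(A + Bρ) ≡ (2a₁ + c₁ρ)²` modulo `ker ψ`, so `ψA + ψB·ψρ` is a square in `ℤ/q` — the
  quadratic character of the degree-one prime `(ker ψ, s − ρ)` of `L`, evaluated without constructing that prime; multiplicative in products.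
* §4 ★ Dirichlet: `rank E_L < 2·#Pl_∞(K)` (Mathlib `InfinitePlace.card_eq_card_isUnramifiedIn`); a root of unity of `L` is `±` a square
  (`√−1 ∉ L`); hence ANY `n > rank E_L` units have a non-empty sub-product equal to `±g²` (the exponent vectors on Mathlib's `fundSystem`
  are dependent modulo `2`).
* §5 `(b,v)² = (w,b²)` and `(w,b²)² = (w)` from explicit ring witnesses.
* §6 ★★ if `(w, b²) = (y)` then `w = u·y²` with `u` a unit, and §4 applied to `u₁, u₂, u₃, u` produces a pattern `(e, ±)` with
  `±u₁^{e₁}u₂^{e₂}u₃^{e₃}w^{e₄}` a square in `L`, contradicting its residue certificate (§3); so `[(b,v)]² ≠ 1 = [(b,v)]⁴`, a class of ORDER `4`.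

HONEST SCOPE: textbook computational algebraic number theory (verification of a class-group/unit computation by an independent certificate,
Cohen §6.5; the `4`-rank via characters, Rédei–Reichardt for quadratic fields); nothing specific to any summit; BSD is not advanced by this file.
USE (cell bsd-f1-sign2, crux C2, hard-core seed `N = 12163` of the u7 sub-cell: `K = ℚ(β)` the cubic field of discriminant `−12163`, `h_K = 1`,
`t = 3`, genus regime (β)): three units of `K(√2)`, the prime `(q₀, s − 3)` above `7` (order `4` in `Cl(K(√2)) ≅ ℤ/4`), and `31` residue
certificates at primes above `7` and `31` give `e₁ = ord₂ h(K(√2)) ≥ 2` in the kernel (Summits row), the displayed input of the pro-cyclic door.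

presearch: «order-4 ideal class certificate / units modulo squares by quadratic characters / 4-rank» → [corpus: cohen1993 pp. 262, 282, 414
(class group and unit algorithms, verification)], [corpus: buell1989 pp. 78–87 (4-rank via genus characters, quadratic case)], [corpus:
buhler2008 pp. 517–529 (Stevenhagen, computational class field theory / verification)]; galaxy all «class of order 4|4-rank of the class
group»: Cohn (construction of class fields), Milovic (16-rank of `ℚ(√−8p)`) — quadratic-field literature only; the relative `K(√2)/K` certificate
is folklore-computational, not found stated.  Expected REF2 placement: TEXTBOOK/COROLLARY-OF-MATHLIB.

References: [NeukirchANT1999] Ch. I §2 (integrality, trace), §3 (ideals, class group), §7 Thm. (7.4) (Dirichlet), §8 (splitting of primes);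
[Cohen1993] §4.8–§4.9 (units and class groups), §6.5 (computing/verifying class groups and units); [Marcus2018] Ch. 3 Thm. 27 (residue maps of
monogenic orders), Ch. 5 (class group computations).
-/

set_option autoImplicit false

noncomputable section

open NumberField NumberField.Units Module
open scoped nonZeroDivisors

namespace Literature.NumberTheory.NumberFields

/-! ## §1 Coordinates in `L = K ⊕ K s` -/

section Coordinates

variable {K L : Type*} [Field K] [Field L] [Algebra K L]

/-- **Uniqueness of coordinates**: `a + c s = a' + c' s` with `a, c, a', c' ∈ K` and `s ∉ K` forces `a = a'`, `c = c'`.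
[cite: NeukirchANT1999, Ch. I §2 (a `K`-basis of a field extension)] -/
theorem coord_unique_of_forall_algebraMap_ne {s : L} (hsK : ∀ k : K, algebraMap K L k ≠ s) {a c a' c' : K}
    (h : algebraMap K L a + algebraMap K L c * s = algebraMap K L a' + algebraMap K L c' * s) : a = a' ∧ c = c' := by
  by_cases hc : c = c'
  · subst hc
    refine ⟨(algebraMap K L).injective ?_, rfl⟩
    exact add_right_cancel h
  · exfalso
    apply hsK ((a - a') / (c' - c))
    have hcL : algebraMap K L (c' - c) ≠ 0 := by
      rw [Ne, map_eq_zero_iff _ (algebraMap K L).injective, sub_eq_zero]; exact Ne.symm hc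
    rw [map_div₀, div_eq_iff hcL, map_sub, map_sub]
    linear_combination h

/-- **Product of coordinates**: `(a + c s)(a' + c' s) = (aa' + 2cc') + (ac' + ca') s` when `s² = 2`.
[cite: NeukirchANT1999, Ch. I §2 (arithmetic in `K(√d) = K ⊕ K√d`)] -/
theorem coord_mul_of_sq_eq_two {s : L} (hs : s ^ 2 = 2) (a c a' c' : K) :
    (algebraMap K L a + algebraMap K L c * s) * (algebraMap K L a' + algebraMap K L c' * s) =
      algebraMap K L (a * a' + 2 * c * c') + algebraMap K L (a * c' + c * a') * s := by
  simp only [map_add, map_mul, map_ofNat]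
  linear_combination (algebraMap K L c * algebraMap K L c') * hs

/-- **`−1` is not a square in `L = K(√2)` when `K` has a real embedding**: `(a + cs)² = −1` gives `a² + 2c² = −1` in `K`, absurd in `ℝ`.
[cite: NeukirchANT1999, Ch. I §7 (roots of unity and real embeddings)] -/
theorem sq_ne_neg_one_of_ringHom_real (h2 : Module.finrank K L = 2) {s : L} (hs : s ^ 2 = 2)
    (hsK : ∀ k : K, algebraMap K L k ≠ s) (φ : K →+* ℝ) (z : L) : z ^ 2 ≠ -1 := by
  intro hz
  obtain ⟨a, c, rfl⟩ := exists_eq_add_mul_of_finrank_eq_two h2 hsK z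
  have hsq : (algebraMap K L a + algebraMap K L c * s) ^ 2 =
      algebraMap K L (a * a + 2 * c * c) + algebraMap K L (a * c + c * a) * s := by
    rw [sq, coord_mul_of_sq_eq_two hs]
  have h1 : algebraMap K L (a * a + 2 * c * c) + algebraMap K L (a * c + c * a) * s =
      algebraMap K L (-1) + algebraMap K L 0 * s := by
    rw [← hsq, hz, map_neg, map_one, map_zero, zero_mul, add_zero]
  obtain ⟨hA, -⟩ := coord_unique_of_forall_algebraMap_ne hsK h1
  have hφ := congrArg φ hA
  rw [map_add, map_mul, map_mul, map_mul, map_ofNat, map_neg, map_one] at hφ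
  nlinarith [sq_nonneg (φ a), sq_nonneg (φ c)]

end Coordinates

/-! ## §2 Integrality: `z ∈ 𝓞_L ⟹ 4z ∈ 𝓞_K + 𝓞_K s` -/

section Integrality

variable {K L : Type*} [Field K] [Field L] [NumberField L] [Algebra K L]
  [FiniteDimensional K L] [IsGalois K L]

/-- **`4·𝓞_L ⊆ 𝓞_K ⊕ 𝓞_K s`** for `L = K(s)`, `s² = 2`: if `z = a + cs` is integral then `2a = z + σz` and `(2cs)² = 8c²` are integral, so
`2a, 4c ∈ 𝓞_K` (`(4c)² = 2·8c²`; `𝓞_K` integrally closed) and `4z = 2(2a) + (4c)s`.  (The conductor of `𝓞_K[√2]` divides `4`.)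
[cite: NeukirchANT1999, Ch. I §2 (integral closure; trace and norm of integral elements)] -/
theorem exists_four_mul_eq_coord_of_isIntegral (h2 : Module.finrank K L = 2) {s : L} (hs : s ^ 2 = 2)
    (hsK : ∀ k : K, algebraMap K L k ≠ s) {z : L} (hz : IsIntegral ℤ z) :
    ∃ a₁ c₁ : 𝓞 K, 4 * z = algebraMap K L (a₁ : K) + algebraMap K L (c₁ : K) * s := by
  obtain ⟨a, c, rfl⟩ := exists_eq_add_mul_of_finrank_eq_two h2 hsK z
  obtain ⟨σ, -, hσs⟩ := exists_algEquiv_ne_one_apply_eq_neg h2 hs hsK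
  have hσz : σ (algebraMap K L a + algebraMap K L c * s) = algebraMap K L a - algebraMap K L c * s := by
    rw [map_add, map_mul, AlgEquiv.commutes, AlgEquiv.commutes, hσs]; ring
  have hσint : IsIntegral ℤ (σ (algebraMap K L a + algebraMap K L c * s)) := map_isIntegral_int (σ : L →+* L) hz
  -- `2a ∈ 𝓞_K`
  have h2a : IsIntegral ℤ (2 * a) := by
    have heq : (algebraMap K L a + algebraMap K L c * s) + (algebraMap K L a - algebraMap K L c * s) =
        algebraMap K L (2 * a) := by
      rw [map_mul, map_ofNat]; ring
    have hsum : IsIntegral ℤ (algebraMap K L (2 * a)) := by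
      have := hz.add hσint
      rwa [hσz, heq] at this
    exact (isIntegral_algebraMap_iff (algebraMap K L).injective).mp hsum
  -- `4c ∈ 𝓞_K`
  have h4c : IsIntegral ℤ (4 * c) := by
    have heq : (algebraMap K L a + algebraMap K L c * s) - (algebraMap K L a - algebraMap K L c * s) =
        algebraMap K L (2 * c) * s := by
      rw [map_mul, map_ofNat]; ring
    have hdiff : IsIntegral ℤ (algebraMap K L (2 * c) * s) := by
      have := hz.sub hσint
      rwa [hσz, heq] at this
    have heq2 : (algebraMap K L (2 * c) * s) * (algebraMap K L (2 * c) * s) * (2 : L) =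
        algebraMap K L (16 * c ^ 2) := by
      simp only [map_mul, map_pow, map_ofNat]
      linear_combination ((8 : L) * (algebraMap K L c) ^ 2) * hs
    have h2int : IsIntegral ℤ (2 : L) := by
      have := isIntegral_algebraMap (R := ℤ) (A := L) (x := (2 : ℤ))
      rwa [map_ofNat] at this
    have hsq : IsIntegral ℤ (algebraMap K L (16 * c ^ 2)) := by
      have := (hdiff.mul hdiff).mul h2int
      rwa [heq2] at this
    have h16 : IsIntegral ℤ (16 * c ^ 2) := (isIntegral_algebraMap_iff (algebraMap K L).injective).mp hsq
    refine IsIntegral.of_pow (n := 2) (by norm_num) ?_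
    have : (4 * c) ^ 2 = 16 * c ^ 2 := by ring
    rwa [this]
  refine ⟨2 * ⟨2 * a, h2a⟩, ⟨4 * c, h4c⟩, ?_⟩
  have h1 : (((2 * ⟨2 * a, h2a⟩ : 𝓞 K)) : K) = 2 * (2 * a) := by push_cast; rfl
  simp only [h1, RingOfIntegers.map_mk, map_mul, map_ofNat]
  ring

end Integrality

/-! ## §3 The residue-symbol obstruction to «`x` is a square in `L`», computed in `𝓞_K` -/

section Residue

variable {K L : Type*} [Field K] [Field L] [NumberField L] [Algebra K L]
  [FiniteDimensional K L] [IsGalois K L]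

/-- ★ **The residue-symbol obstruction.**  `L/K` Galois quadratic, `s² = 2`, `s ∉ K`; `ψ : 𝓞_K → ℤ/q` a ring homomorphism with `2` invertible
(`2t = 1`) and `ρ ∈ 𝓞_K` with `ψ(ρ)² = 2` (a square root of `2` modulo the prime `ker ψ`, which therefore SPLITS in `L`).  If `A + B s` (`A, B ∈ 𝓞_K`)
is a square in `L` then `ψ(A) + ψ(B)ψ(ρ)` is a square in `ℤ/q`.  (If `z² = A + Bs` then `4z = a₁ + c₁ s` with `a₁, c₁ ∈ 𝓞_K` (§2), so
`16A = a₁² + 2c₁²`, `16B = 2a₁c₁`, and `ψ(a₁ + c₁ρ)² = 16·(ψA + ψB·ψρ)`.)  This is the value at `A + Bs` of the quadratic character of the residue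
field `𝓞_L/𝔔 ≅ 𝓞_K/ker ψ` of the prime `𝔔 = (ker ψ, s − ρ)` — computed without constructing `𝔔`.
[cite: NeukirchANT1999, Ch. I §8 (decomposition of primes in `K(√2)`; residue fields of split primes)] [cite: Marcus2018, Ch. 3, Thm. 27] -/
theorem isSquare_residue_of_sq_eq_coord (h2 : Module.finrank K L = 2) {s : L} (hs : s ^ 2 = 2)
    (hsK : ∀ k : K, algebraMap K L k ≠ s) {q : ℕ} (ψ : 𝓞 K →+* ZMod q) {t : ZMod q} (ht : 2 * t = 1)
    {ρ : 𝓞 K} (hρ : ψ ρ ^ 2 = 2) {A B : 𝓞 K} {z : L}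
    (hz : z ^ 2 = algebraMap K L (A : K) + algebraMap K L (B : K) * s) :
    IsSquare (ψ A + ψ B * ψ ρ) := by
  -- `z` is integral: `z² = A + B s` is
  have hsint : IsIntegral ℤ s := by
    refine ⟨Polynomial.X ^ 2 - Polynomial.C 2, Polynomial.monic_X_pow_sub_C _ two_ne_zero, ?_⟩
    simp [hs]
  have hzint : IsIntegral ℤ z := by
    refine IsIntegral.of_pow (n := 2) (by norm_num) ?_
    rw [hz]
    exact ((isIntegral_algebraMap_iff (algebraMap K L).injective).mpr A.2).add
      (((isIntegral_algebraMap_iff (algebraMap K L).injective).mpr B.2).mul hsint)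
  obtain ⟨a₁, c₁, h4z⟩ := exists_four_mul_eq_coord_of_isIntegral h2 hs hsK hzint
  -- compare coordinates of `16 z²`
  have h16 : algebraMap K L ((16 : K) * A) + algebraMap K L ((16 : K) * B) * s =
      algebraMap K L ((a₁ : K) * a₁ + 2 * c₁ * c₁) + algebraMap K L ((a₁ : K) * c₁ + c₁ * a₁) * s := by
    rw [← coord_mul_of_sq_eq_two hs, ← h4z, map_mul, map_mul, map_ofNat]
    linear_combination (-16 : L) * hz
  obtain ⟨hA, hB⟩ := coord_unique_of_forall_algebraMap_ne hsK h16
  have hA' : (16 : 𝓞 K) * A = a₁ * a₁ + 2 * c₁ * c₁ := by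
    apply RingOfIntegers.coe_injective; push_cast; exact hA
  have hB' : (16 : 𝓞 K) * B = a₁ * c₁ + c₁ * a₁ := by
    apply RingOfIntegers.coe_injective; push_cast; exact hB
  have hψA := congrArg ψ hA'
  have hψB := congrArg ψ hB'
  simp only [map_mul, map_add, map_ofNat] at hψA hψB
  refine ⟨(ψ a₁ + ψ c₁ * ψ ρ) * t ^ 2, ?_⟩
  linear_combination (t ^ 4) * hψA + (t ^ 4 * ψ ρ) * hψB + (-(t ^ 4) * (ψ c₁) ^ 2) * hρ +
    (-(ψ A + ψ B * ψ ρ) * (8 * t ^ 3 + 4 * t ^ 2 + 2 * t + 1)) * ht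

omit [NumberField L] [FiniteDimensional K L] [IsGalois K L] in
/-- **Coordinates of a product, with the symbol**: if `y = A + Bs`, `y' = C + Ds` with `ψ(A) + ψ(B)ψ(ρ) = v`, `ψ(C) + ψ(D)ψ(ρ) = v'`, then
`yy' = (AC + 2BD) + (AD + BC)s` and its symbol is `vv'` (`ψ(ρ)² = 2`). [folklore] -/
private theorem exists_coord_mul_of_coord {s : L} (hs : s ^ 2 = 2) {q : ℕ} (ψ : 𝓞 K →+* ZMod q) {ρ : 𝓞 K} (hρ : ψ ρ ^ 2 = 2)
    {y y' : L} {v v' : ZMod q}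
    (hy : ∃ A B : 𝓞 K, y = algebraMap K L (A : K) + algebraMap K L (B : K) * s ∧ ψ A + ψ B * ψ ρ = v)
    (hy' : ∃ C D : 𝓞 K, y' = algebraMap K L (C : K) + algebraMap K L (D : K) * s ∧ ψ C + ψ D * ψ ρ = v') :
    ∃ E F : 𝓞 K, y * y' = algebraMap K L (E : K) + algebraMap K L (F : K) * s ∧ ψ E + ψ F * ψ ρ = v * v' := by
  obtain ⟨A, B, rfl, rfl⟩ := hy
  obtain ⟨C, D, rfl, rfl⟩ := hy'
  refine ⟨A * C + B * D + B * D, A * D + B * C, ?_, ?_⟩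
  · push_cast
    linear_combination (algebraMap K L (B : K) * algebraMap K L (D : K)) * hs
  · simp only [map_add, map_mul]
    linear_combination (-(ψ B * ψ D)) * hρ

omit [NumberField L] [FiniteDimensional K L] [IsGalois K L] in
/-- **Coordinates of a power, with the symbol.** [folklore] -/
private theorem exists_coord_pow_of_coord {s : L} (hs : s ^ 2 = 2) {q : ℕ} (ψ : 𝓞 K →+* ZMod q) {ρ : 𝓞 K} (hρ : ψ ρ ^ 2 = 2)
    {y : L} {v : ZMod q}
    (hy : ∃ A B : 𝓞 K, y = algebraMap K L (A : K) + algebraMap K L (B : K) * s ∧ ψ A + ψ B * ψ ρ = v) (n : ℕ) :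
    ∃ E F : 𝓞 K, y ^ n = algebraMap K L (E : K) + algebraMap K L (F : K) * s ∧ ψ E + ψ F * ψ ρ = v ^ n := by
  induction n with
  | zero => exact ⟨1, 0, by simp, by simp⟩
  | succ n ih =>
    obtain ⟨E, F, hE, hv⟩ := exists_coord_mul_of_coord hs ψ hρ ih hy
    exact ⟨E, F, by rw [pow_succ, hE], by rw [pow_succ, hv]⟩

omit [NumberField L] [FiniteDimensional K L] [IsGalois K L] in
/-- **Coordinates of `±1`, with the symbol.** [folklore] -/
private theorem exists_coord_unitsInt (s : L) {q : ℕ} (ψ : 𝓞 K →+* ZMod q) (ρ : 𝓞 K) (σ : ℤˣ) :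
    ∃ A B : 𝓞 K, ((σ : ℤ) : L) = algebraMap K L (A : K) + algebraMap K L (B : K) * s ∧ ψ A + ψ B * ψ ρ = ((σ : ℤ) : ZMod q) := by
  refine ⟨(σ : ℤ), 0, ?_, ?_⟩
  · push_cast; simp
  · simp

/-- ★ **The obstruction for a signed product of four coordinate elements** (`x_i = a_i + b_i s`, exponents `e_i`): if
`±x₀^{e₀}x₁^{e₁}x₂^{e₂}x₃^{e₃}` is a square in `L` then `±∏ (ψ a_i + ψ b_i ψρ)^{e_i}` is a square in `ℤ/q` (from
`isSquare_residue_of_sq_eq_coord`; the residue map is multiplicative).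
[cite: NeukirchANT1999, Ch. I §8 (residue fields of the primes of `K(√2)` above a split prime)] [cite: Marcus2018, Ch. 3, Thm. 27] -/
theorem isSquare_residue_of_sq_eq_prod (h2 : Module.finrank K L = 2) {s : L} (hs : s ^ 2 = 2)
    (hsK : ∀ k : K, algebraMap K L k ≠ s) {q : ℕ} (ψ : 𝓞 K →+* ZMod q) {t : ZMod q} (ht : 2 * t = 1)
    {ρ : 𝓞 K} (hρ : ψ ρ ^ 2 = 2) (a₀ b₀ a₁ b₁ a₂ b₂ a₃ b₃ : 𝓞 K) {x₀ x₁ x₂ x₃ : L}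
    (hx₀ : x₀ = algebraMap K L (a₀ : K) + algebraMap K L (b₀ : K) * s)
    (hx₁ : x₁ = algebraMap K L (a₁ : K) + algebraMap K L (b₁ : K) * s)
    (hx₂ : x₂ = algebraMap K L (a₂ : K) + algebraMap K L (b₂ : K) * s)
    (hx₃ : x₃ = algebraMap K L (a₃ : K) + algebraMap K L (b₃ : K) * s)
    (e₀ e₁ e₂ e₃ : ℕ) (σ : ℤˣ) {z : L}
    (hz : z ^ 2 = ((σ : ℤ) : L) * x₀ ^ e₀ * x₁ ^ e₁ * x₂ ^ e₂ * x₃ ^ e₃) :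
    IsSquare (((σ : ℤ) : ZMod q) * (ψ a₀ + ψ b₀ * ψ ρ) ^ e₀ * (ψ a₁ + ψ b₁ * ψ ρ) ^ e₁ *
      (ψ a₂ + ψ b₂ * ψ ρ) ^ e₂ * (ψ a₃ + ψ b₃ * ψ ρ) ^ e₃) := by
  have h0 := exists_coord_pow_of_coord hs ψ hρ ⟨a₀, b₀, hx₀, rfl⟩ e₀
  have h1 := exists_coord_pow_of_coord hs ψ hρ ⟨a₁, b₁, hx₁, rfl⟩ e₁
  have h2' := exists_coord_pow_of_coord hs ψ hρ ⟨a₂, b₂, hx₂, rfl⟩ e₂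
  have h3 := exists_coord_pow_of_coord hs ψ hρ ⟨a₃, b₃, hx₃, rfl⟩ e₃
  have hσ := exists_coord_unitsInt (K := K) s ψ ρ σ
  obtain ⟨E, F, hE, hv⟩ := exists_coord_mul_of_coord hs ψ hρ
    (exists_coord_mul_of_coord hs ψ hρ (exists_coord_mul_of_coord hs ψ hρ (exists_coord_mul_of_coord hs ψ hρ hσ h0) h1) h2') h3
  rw [← hv]
  exact isSquare_residue_of_sq_eq_coord h2 hs hsK ψ ht hρ (z := z) (by rw [hz, hE])

end Residue

/-! ## §4 Units of `L` modulo `±` squares (Dirichlet) -/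

section UnitsModSquares

/-- `∏ᵢ a^{f i} = a^{∑ f i}` for integer exponents in a commutative group. [folklore] -/
private theorem prod_zpow_eq_zpow_sum {G ι : Type*} [CommGroup G] (a : G) (s : Finset ι) (f : ι → ℤ) :
    ∏ i ∈ s, a ^ f i = a ^ ∑ i ∈ s, f i := by
  classical
  induction s using Finset.induction_on with
  | empty => simp
  | insert i s hi ih => rw [Finset.prod_insert hi, Finset.sum_insert hi, zpow_add, ih]

variable {L : Type*} [Field L] [NumberField L]

omit [NumberField L] in
/-- **A root of unity of `L` is `±` the square of a unit when `√−1 ∉ L`.**  If `ζ` has odd order `2k+1` then `ζ = (ζ^{k+1})²`; if the order is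
`2k` then `ζ^k = −1` (the only element of order `2` of a field), and `k` odd gives `ζ = −(ζ^{−(k−1)/2})²` while `k` even would make `ζ^{k/2}`
a square root of `−1`. [cite: NeukirchANT1999, Ch. I §7 (the roots of unity of a number field form a finite cyclic group)] -/
theorem exists_eq_sq_or_eq_neg_sq_of_mem_torsion (hi : ∀ z : L, z ^ 2 ≠ -1) {ζ : (𝓞 L)ˣ} (hζ : ζ ∈ torsion L) :
    ∃ t : (𝓞 L)ˣ, ζ = t ^ 2 ∨ ζ = -t ^ 2 := by
  have hfin : IsOfFinOrder ζ := (CommGroup.mem_torsion ζ).mp hζ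
  set m := orderOf ζ with hm
  have hm0 : 0 < m := hfin.orderOf_pos
  have hζm : ζ ^ m = 1 := pow_orderOf_eq_one ζ
  rcases Nat.even_or_odd m with ⟨k, hk⟩ | ⟨k, hk⟩
  · -- even order `m = k + k`: `ζ^k = −1`
    have hk0 : 0 < k := by omega
    have hζk : (ζ ^ k) ^ 2 = 1 := by rw [← pow_mul, show k * 2 = m by omega]; exact hζm
    have hne : ζ ^ k ≠ 1 := pow_ne_one_of_lt_orderOf hk0.ne' (by omega)
    have hneg : ζ ^ k = -1 := by
      have hval : (((ζ ^ k : (𝓞 L)ˣ)) : 𝓞 L) ^ 2 = 1 := by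
        rw [← Units.val_pow_eq_pow_val, hζk, Units.val_one]
      rcases sq_eq_one_iff.mp hval with h | h
      · exact absurd (Units.val_eq_one.mp h) hne
      · exact Units.val_inj.mp (by rw [h, Units.val_neg, Units.val_one])
    rcases Nat.even_or_odd k with ⟨j, hj⟩ | ⟨j, hj⟩
    · -- `k = j + j`: `(ζ^j)² = −1` in `L` — impossible
      exfalso
      apply hi ((((ζ ^ j : (𝓞 L)ˣ)) : 𝓞 L) : L)
      have hu : (ζ ^ j) ^ 2 = -1 := by rw [← pow_mul, show j * 2 = k by omega, hneg]
      have h' := congrArg (fun u : (𝓞 L)ˣ => (((u : 𝓞 L)) : L)) hu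
      simpa using h'
    · -- `k = 2j + 1`: `ζ · (ζ^j)² = −1`
      refine ⟨(ζ ^ j)⁻¹, Or.inr ?_⟩
      have hζj : ζ * (ζ ^ j) ^ 2 = -1 := by
        rw [← pow_mul, ← pow_succ', show j * 2 + 1 = k by omega, hneg]
      calc ζ = ζ * (ζ ^ j) ^ 2 * ((ζ ^ j)⁻¹) ^ 2 := by rw [inv_pow, mul_inv_cancel_right]
        _ = -((ζ ^ j)⁻¹) ^ 2 := by rw [hζj, neg_one_mul]
  · -- odd order `m = 2k + 1`: `ζ = (ζ^{k+1})²`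
    refine ⟨ζ ^ (k + 1), Or.inl ?_⟩
    calc ζ = ζ ^ m * ζ := by rw [hζm, one_mul]
      _ = (ζ ^ (k + 1)) ^ 2 := by rw [hk, ← pow_succ, ← pow_mul]; congr 1; ring

/-- ★ **Dirichlet: `n > rank E_L` units have a non-empty sub-product that is `±` a square.**  Write each `y_i = ζ_i ∏_j f_j^{E_{ij}}` on the
fundamental system (Mathlib `exist_unique_eq_mul_prod`); the `n` vectors `(E_{ij} mod 2)_j` in `𝔽₂^{rank}` are dependent, giving `e ∈ {0,1}^n ∖ 0` with all
`∑_i e_i E_{ij}` even; then `∏ y_i^{e_i} = ζ · (∏_j f_j^{F_j})²` with `ζ` a root of unity, which is `±` a square (`√−1 ∉ L`).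
[cite: NeukirchANT1999, Ch. I §7 Thm. (7.4) (Dirichlet's unit theorem: `E_L ≅ μ_L × ℤ^{r₁+r₂−1}`)] -/
theorem exists_prod_pow_eq_sq_of_rank_lt (hi : ∀ z : L, z ^ 2 ≠ -1) {n : ℕ} (hn : rank L < n)
    (y : Fin n → (𝓞 L)ˣ) :
    ∃ e : Fin n → ℕ, (∀ i, e i ≤ 1) ∧ e ≠ 0 ∧
      ∃ g : (𝓞 L)ˣ, (∏ i, y i ^ e i = g ^ 2 ∨ ∏ i, y i ^ e i = -g ^ 2) := by
  classical
  have hrep : ∀ i, ∃ ζe : torsion L × (Fin (rank L) → ℤ), y i = ζe.1 * ∏ j, fundSystem L j ^ ζe.2 j :=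
    fun i => (exist_unique_eq_mul_prod L (y i)).exists
  choose ζe hζe using hrep
  -- the exponent vectors modulo `2` are linearly dependent
  let v : Fin n → (Fin (rank L) → ZMod 2) := fun i j => ((ζe i).2 j : ZMod 2)
  have hdep : ¬ LinearIndependent (ZMod 2) v := by
    intro h
    have := h.fintype_card_le_finrank
    rw [Fintype.card_fin, Module.finrank_fintype_fun_eq_card, Fintype.card_fin] at this
    omega
  obtain ⟨g, hg, i₀, hi₀⟩ := Fintype.not_linearIndependent_iff.mp hdep
  refine ⟨fun i => (g i).val, fun i => ?_, ?_, ?_⟩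
  · show (g i).val ≤ 1
    have := ZMod.val_lt (g i); omega
  · intro h
    apply hi₀
    have h0 : (g i₀).val = 0 := congrFun h i₀
    exact (ZMod.val_eq_zero _).mp h0
  · -- every column sum `∑_i e_i E_{ij}` is even
    have hcol : ∀ j, ∃ F : ℤ, ∑ i, ((g i).val : ℤ) * (ζe i).2 j = 2 * F := by
      intro j
      have hj : (∑ i, g i • v i) j = 0 := by rw [hg]; rfl
      rw [Finset.sum_apply] at hj
      simp only [Pi.smul_apply, smul_eq_mul, v] at hj
      have hdvd : ((2 : ℕ) : ℤ) ∣ ∑ i, ((g i).val : ℤ) * (ζe i).2 j := by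
        rw [← ZMod.intCast_zmod_eq_zero_iff_dvd]
        push_cast
        simpa only [ZMod.natCast_val, ZMod.cast_id', id_eq] using hj
      obtain ⟨F, hF⟩ := hdvd
      exact ⟨F, by rw [hF]; rfl⟩
    choose F hF using hcol
    -- the torsion factor
    have htors : (∏ i, ((ζe i).1 : (𝓞 L)ˣ) ^ (g i).val) ∈ torsion L :=
      Subgroup.prod_mem _ fun i _ => Subgroup.pow_mem _ (ζe i).1.2 _
    obtain ⟨t, ht⟩ := exists_eq_sq_or_eq_neg_sq_of_mem_torsion hi htors
    refine ⟨t * ∏ j, fundSystem L j ^ F j, ?_⟩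
    have key : ∏ i, y i ^ (g i).val =
        (∏ i, ((ζe i).1 : (𝓞 L)ˣ) ^ (g i).val) * (∏ j, fundSystem L j ^ F j) ^ 2 := by
      calc ∏ i, y i ^ (g i).val
          = ∏ i, (((ζe i).1 : (𝓞 L)ˣ) ^ (g i).val * ∏ j, fundSystem L j ^ ((ζe i).2 j * ((g i).val : ℤ))) := by
            refine Finset.prod_congr rfl fun i _ => ?_
            rw [hζe i, mul_pow, ← Finset.prod_pow]
            congr 1
            refine Finset.prod_congr rfl fun j _ => ?_
            rw [← zpow_natCast, ← zpow_mul]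
        _ = (∏ i, ((ζe i).1 : (𝓞 L)ˣ) ^ (g i).val) *
              ∏ i, ∏ j, fundSystem L j ^ ((ζe i).2 j * ((g i).val : ℤ)) := Finset.prod_mul_distrib
        _ = (∏ i, ((ζe i).1 : (𝓞 L)ˣ) ^ (g i).val) *
              ∏ j, ∏ i, fundSystem L j ^ ((ζe i).2 j * ((g i).val : ℤ)) := by rw [Finset.prod_comm]
        _ = (∏ i, ((ζe i).1 : (𝓞 L)ˣ) ^ (g i).val) * ∏ j, fundSystem L j ^ (2 * F j) := by
            congr 1
            refine Finset.prod_congr rfl fun j _ => ?_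
            rw [prod_zpow_eq_zpow_sum, ← hF j]
            congr 1
            exact Finset.sum_congr rfl fun i _ => mul_comm _ _
        _ = (∏ i, ((ζe i).1 : (𝓞 L)ˣ) ^ (g i).val) * (∏ j, fundSystem L j ^ F j) ^ 2 := by
            congr 1
            rw [← Finset.prod_pow]
            refine Finset.prod_congr rfl fun j _ => ?_
            rw [← zpow_natCast (fundSystem L j ^ F j) 2, ← zpow_mul, mul_comm]
            rfl
    rcases ht with ht | ht
    · exact Or.inl (by rw [key, ht, mul_pow])
    · exact Or.inr (by rw [key, ht, mul_pow, neg_mul])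

/-- **`rank E_L < 2·#Pl_∞(K)`** for `L/K` Galois of degree `2`: every infinite place of `K` has at most two places of `L` above it
(Mathlib `InfinitePlace.card_eq_card_isUnramifiedIn`), so `#Pl_∞(L) ≤ 2·#Pl_∞(K)` and `rank E_L = #Pl_∞(L) − 1`.
[cite: NeukirchANT1999, Ch. I §7 Thm. (7.4)] -/
theorem units_rank_lt_of_finrank_eq_two {K : Type*} [Field K] [NumberField K] [Algebra K L] [IsGalois K L]
    (h2 : Module.finrank K L = 2) {n : ℕ} (hn : 2 * Fintype.card (InfinitePlace K) ≤ n) : rank L < n := by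
  classical
  have hcard := NumberField.InfinitePlace.card_eq_card_isUnramifiedIn (k := K) (K := L)
  rw [h2] at hcard
  have htot := Finset.card_add_card_compl (Finset.univ.filter fun w : InfinitePlace K => w.IsUnramifiedIn L)
  have hle : Fintype.card (InfinitePlace L) ≤ 2 * Fintype.card (InfinitePlace K) := by
    rw [hcard, ← htot]; omega
  have hpos : 0 < Fintype.card (InfinitePlace L) := Fintype.card_pos
  rw [rank]
  omega

/-- **A real place of `K` gives `K →+* ℝ`** (Mathlib `embedding_of_isReal`). [folklore] -/
private theorem exists_ringHom_real_of_nrRealPlaces_pos {K : Type*} [Field K] [NumberField K]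
    (h : 0 < NumberField.InfinitePlace.nrRealPlaces K) : Nonempty (K →+* ℝ) := by
  classical
  obtain ⟨⟨w, hw⟩⟩ := Fintype.card_pos_iff.mp h
  exact ⟨NumberField.InfinitePlace.embedding_of_isReal hw⟩

end UnitsModSquares

/-! ## §5 Two explicit ideal identities from ring witnesses -/

section Ideals

variable {R : Type*} [CommRing R]

/-- **`(b, v)² = (w, b²)`** from witnesses: `bv = αw + βb²`, `v² = α'w + β'b²`, `w = α''b² + β''·bv + γ''v²` (ideal products on generators).
[cite: NeukirchANT1999, Ch. I §3 (products of ideals; Dedekind domains)] [cite: Cohen1993, §4.7 (ideal arithmetic on two-element representations)] -/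
theorem span_pair_sq_eq_span_pair_of_witnesses {b v w α β α' β' α'' β'' γ'' : R}
    (h1 : b * v = α * w + β * b ^ 2) (h2 : v ^ 2 = α' * w + β' * b ^ 2)
    (h3 : w = α'' * b ^ 2 + β'' * (b * v) + γ'' * v ^ 2) :
    (Ideal.span {b, v}) ^ 2 = Ideal.span {w, b ^ 2} := by
  apply le_antisymm
  · rw [pow_two, Ideal.span_pair_mul_span_pair, Ideal.span_le]
    intro x hx
    simp only [Set.mem_insert_iff, Set.mem_singleton_iff] at hx
    rw [SetLike.mem_coe, Ideal.mem_span_pair]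
    rcases hx with rfl | rfl | rfl | rfl
    · exact ⟨0, 1, by ring⟩
    · exact ⟨α, β, by rw [h1]⟩
    · exact ⟨α, β, by rw [mul_comm v b, h1]⟩
    · exact ⟨α', β', by rw [← pow_two, h2]⟩
  · rw [Ideal.span_le]
    intro x hx
    simp only [Set.mem_insert_iff, Set.mem_singleton_iff] at hx
    have hb : b ∈ Ideal.span {b, v} := Ideal.subset_span (by simp)
    have hv : v ∈ Ideal.span {b, v} := Ideal.subset_span (by simp)
    rw [SetLike.mem_coe, pow_two]
    rcases hx with rfl | rfl
    · rw [h3]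
      refine Ideal.add_mem _ (Ideal.add_mem _ ?_ ?_) ?_
      · rw [pow_two]; exact Ideal.mul_mem_left _ _ (Ideal.mul_mem_mul hb hb)
      · exact Ideal.mul_mem_left _ _ (Ideal.mul_mem_mul hb hv)
      · rw [pow_two]; exact Ideal.mul_mem_left _ _ (Ideal.mul_mem_mul hv hv)
    · rw [pow_two]; exact Ideal.mul_mem_mul hb hb

/-- **`(w, b²)² = (w)`** from witnesses: `b⁴ = w·w*` and `μw + νw* = 1` (so `w = μw² + νb⁴`).
[cite: NeukirchANT1999, Ch. I §3 (products of ideals; Dedekind domains)] [cite: Cohen1993, §4.7 (ideal arithmetic on two-element representations)] -/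
theorem span_pair_sq_eq_span_singleton_of_witnesses {b w ws μ ν : R}
    (hws : b ^ 4 = w * ws) (hbez : μ * w + ν * ws = 1) :
    (Ideal.span {w, b ^ 2}) ^ 2 = Ideal.span {w} := by
  apply le_antisymm
  · rw [pow_two, Ideal.span_pair_mul_span_pair, Ideal.span_le]
    intro x hx
    simp only [Set.mem_insert_iff, Set.mem_singleton_iff] at hx
    rw [SetLike.mem_coe, Ideal.mem_span_singleton']
    rcases hx with rfl | rfl | rfl | rfl
    · exact ⟨w, rfl⟩
    · exact ⟨b ^ 2, by ring⟩
    · exact ⟨b ^ 2, by ring⟩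
    · exact ⟨ws, by rw [mul_comm ws w, ← hws]; ring⟩
  · rw [Ideal.span_le, Set.singleton_subset_iff, SetLike.mem_coe, pow_two]
    have hw : w ∈ Ideal.span {w, b ^ 2} := Ideal.subset_span (by simp)
    have hb : b ^ 2 ∈ Ideal.span {w, b ^ 2} := Ideal.subset_span (by simp)
    have key : μ * (w * w) + ν * (b ^ 2 * b ^ 2) = w := by
      have h4 : b ^ 2 * b ^ 2 = w * ws := by rw [← hws]; ring
      rw [h4]
      linear_combination w * hbez
    have hmem : μ * (w * w) + ν * (b ^ 2 * b ^ 2) ∈ Ideal.span {w, b ^ 2} * Ideal.span {w, b ^ 2} :=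
      Ideal.add_mem _ (Ideal.mul_mem_left _ _ (Ideal.mul_mem_mul hw hw)) (Ideal.mul_mem_left _ _ (Ideal.mul_mem_mul hb hb))
    rwa [key] at hmem

end Ideals

/-! ## §6 The order-four certificate -/

section Main

variable {K L : Type*} [Field K] [NumberField K] [Field L] [NumberField L] [Algebra K L]
  [FiniteDimensional K L] [IsGalois K L]

/-- ★★ **THE ORDER-FOUR CERTIFICATE: `4 ∣ h_L`.**  `L/K` Galois of degree `2`, `s ∈ L`, `s² = 2`, `s ∉ K`; `K` has a real place and at most two
infinite places (so `√−1 ∉ L` and `rank E_L ≤ 3`).  DATA: three units `u₁, u₂, u₃` of `𝓞_L` and an element `w` with coordinates `a_i + b_i s`, `A + B s`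
(`a_i, b_i, A, B ∈ 𝓞_K`); elements `b ≠ 0`, `v` of `𝓞_L` with `(b, v)² = (w, b²)` and `(w, b²)² = (w)`; and RESIDUE CERTIFICATES: for every
`(e₁, e₂, e₃, e₄, ±) ≠ (0,0,0,0,+)` with `e_i ∈ {0,1}` a ring homomorphism `ψ : 𝓞_K → ℤ/q` with `2` invertible, `ρ` with `ψ(ρ)² = 2`, such that
`±∏ (ψ a_i + ψ b_i ψρ)^{e_i} · (ψA + ψB ψρ)^{e₄}` is NOT a square in `ℤ/q`.  THEN `4 ∣ #Cl(L)`.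
PROOF.  If `(w, b²) = (y)` then `(y²) = (w)`, `w = u y²` with `u` a unit; by §4 some `±u₁^{e₁}u₂^{e₂}u₃^{e₃}u^{e₄}` (`e ≠ 0`) is the square of a unit,
hence (multiplying by `y^{2e₄}`) `±u₁^{e₁}u₂^{e₂}u₃^{e₃}w^{e₄}` is a square in `L`, contradicting the certificate via §3.  So the class of `𝔅 = (b, v)`
satisfies `[𝔅]² ≠ 1 = [𝔅]⁴`: it has order `4`, and `4 ∣ #Cl(L)`.  (Elementary: Dirichlet's unit theorem, unique factorisation of ideals, residue maps;
no class field theory.) [cite: NeukirchANT1999, Ch. I §7 Thm. (7.4), Ch. I §3 (ideal classes), Ch. I §8 (split primes)] [cite: Marcus2018, Ch. 5 (class group computations)] -/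
theorem four_dvd_card_classGroup_of_orderFourCert (h2 : Module.finrank K L = 2) {s : L} (hs : s ^ 2 = 2)
    (hsK : ∀ k : K, algebraMap K L k ≠ s) (hreal : 0 < NumberField.InfinitePlace.nrRealPlaces K)
    (hK : Fintype.card (InfinitePlace K) ≤ 2)
    (u₁ u₂ u₃ : (𝓞 L)ˣ) {a₁ b₁ a₂ b₂ a₃ b₃ A B : 𝓞 K} {w b v : 𝓞 L}
    (hu₁ : (((u₁ : 𝓞 L)) : L) = algebraMap K L (a₁ : K) + algebraMap K L (b₁ : K) * s)
    (hu₂ : (((u₂ : 𝓞 L)) : L) = algebraMap K L (a₂ : K) + algebraMap K L (b₂ : K) * s)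
    (hu₃ : (((u₃ : 𝓞 L)) : L) = algebraMap K L (a₃ : K) + algebraMap K L (b₃ : K) * s)
    (hw : ((w : 𝓞 L) : L) = algebraMap K L (A : K) + algebraMap K L (B : K) * s) (hb : b ≠ 0)
    (hI2 : (Ideal.span {b, v}) ^ 2 = Ideal.span {w, b ^ 2}) (hI4 : (Ideal.span {w, b ^ 2}) ^ 2 = Ideal.span {w})
    (hcert : ∀ (e₁ e₂ e₃ e₄ : ℕ) (σ : ℤˣ), e₁ ≤ 1 → e₂ ≤ 1 → e₃ ≤ 1 → e₄ ≤ 1 →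
      ¬ (e₁ = 0 ∧ e₂ = 0 ∧ e₃ = 0 ∧ e₄ = 0 ∧ σ = 1) →
      ∃ (q : ℕ) (ψ : 𝓞 K →+* ZMod q) (t : ZMod q) (ρ : 𝓞 K), 2 * t = 1 ∧ ψ ρ ^ 2 = 2 ∧
        ¬ IsSquare (((σ : ℤ) : ZMod q) * (ψ a₁ + ψ b₁ * ψ ρ) ^ e₁ * (ψ a₂ + ψ b₂ * ψ ρ) ^ e₂ *
          (ψ a₃ + ψ b₃ * ψ ρ) ^ e₃ * (ψ A + ψ B * ψ ρ) ^ e₄)) :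
    4 ∣ Nat.card (ClassGroup (𝓞 L)) := by
  classical
  haveI : Fact (Nat.Prime 2) := ⟨Nat.prime_two⟩
  obtain ⟨φ⟩ := exists_ringHom_real_of_nrRealPlaces_pos hreal
  have hi : ∀ z : L, z ^ 2 ≠ -1 := sq_ne_neg_one_of_ringHom_real h2 hs hsK φ
  have hrank : rank L < 4 := units_rank_lt_of_finrank_eq_two (K := K) h2 (by omega)
  -- no `±u₁^{e₁}u₂^{e₂}u₃^{e₃}w^{e₄}` is a square in `L`
  have hnsq : ∀ (e₁ e₂ e₃ e₄ : ℕ) (σ : ℤˣ), e₁ ≤ 1 → e₂ ≤ 1 → e₃ ≤ 1 → e₄ ≤ 1 →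
      ¬ (e₁ = 0 ∧ e₂ = 0 ∧ e₃ = 0 ∧ e₄ = 0 ∧ σ = 1) →
      ∀ z : L, z ^ 2 ≠ ((σ : ℤ) : L) * (((u₁ : 𝓞 L)) : L) ^ e₁ * (((u₂ : 𝓞 L)) : L) ^ e₂ *
        (((u₃ : 𝓞 L)) : L) ^ e₃ * ((w : 𝓞 L) : L) ^ e₄ := by
    intro e₁ e₂ e₃ e₄ σ h₁ h₂' h₃ h₄ hne z hz
    obtain ⟨q, ψ, t, ρ, ht, hρ, hns⟩ := hcert e₁ e₂ e₃ e₄ σ h₁ h₂' h₃ h₄ hne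
    exact hns (isSquare_residue_of_sq_eq_prod h2 hs hsK ψ ht hρ a₁ b₁ a₂ b₂ a₃ b₃ A B hu₁ hu₂ hu₃ hw e₁ e₂ e₃ e₄ σ hz)
  -- `𝔍 = (w, b²)` is not principal
  have hJ : ¬ (Ideal.span {w, b ^ 2}).IsPrincipal := by
    rintro ⟨y, hy⟩
    rw [Ideal.submodule_span_eq] at hy
    have hy2 : Ideal.span {y ^ 2} = Ideal.span {w} := by rw [← Ideal.span_singleton_pow, ← hy, hI4]
    obtain ⟨u, hu⟩ := Ideal.span_singleton_eq_span_singleton.mp hy2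
    -- `w = y² u`; a relation among `u₁, u₂, u₃, u`
    obtain ⟨e, he1, he0, g, hg⟩ := exists_prod_pow_eq_sq_of_rank_lt hi hrank ![u₁, u₂, u₃, u]
    rw [Fin.prod_univ_four] at hg
    simp only [Matrix.cons_val_zero, Matrix.cons_val_one, Matrix.cons_val] at hg
    have he3 : e 3 = 0 ∨ e 3 = 1 := by have := he1 3; omega
    -- the sign and the square
    have hsq : ∃ (σ : ℤˣ) (g' : L),
        g' ^ 2 = ((σ : ℤ) : L) * (((u₁ : 𝓞 L)) : L) ^ e 0 * (((u₂ : 𝓞 L)) : L) ^ e 1 *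
          (((u₃ : 𝓞 L)) : L) ^ e 2 * ((w : 𝓞 L) : L) ^ e 3 := by
      -- `u^{e 3} · y^{2 e 3} = w^{e 3}` in `𝓞 L`
      have hwe : ((u : 𝓞 L)) ^ e 3 * (y ^ e 3) ^ 2 = w ^ e 3 := by
        rw [← hu]; ring
      have hwe' := congrArg (fun x : 𝓞 L => (x : L)) hwe
      push_cast at hwe'
      rcases hg with hg | hg
      · refine ⟨1, (((g : 𝓞 L)) : L) * ((y : 𝓞 L) : L) ^ e 3, ?_⟩
        have hg' := congrArg (fun x : (𝓞 L)ˣ => (((x : 𝓞 L)) : L)) hg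
        simp only [Units.val_mul, Units.val_pow_eq_pow_val] at hg'
        push_cast at hg' ⊢
        rw [← hwe']
        linear_combination (-(((y : 𝓞 L) : L) ^ e 3) ^ 2) * hg'
      · refine ⟨-1, (((g : 𝓞 L)) : L) * ((y : 𝓞 L) : L) ^ e 3, ?_⟩
        have hg' := congrArg (fun x : (𝓞 L)ˣ => (((x : 𝓞 L)) : L)) hg
        simp only [Units.val_mul, Units.val_pow_eq_pow_val, Units.val_neg] at hg'
        push_cast at hg' ⊢
        rw [← hwe']
        linear_combination ((((y : 𝓞 L) : L) ^ e 3) ^ 2) * hg'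
    obtain ⟨σ, g', hg'⟩ := hsq
    refine hnsq (e 0) (e 1) (e 2) (e 3) σ (he1 0) (he1 1) (he1 2) (he1 3) ?_ g' hg'
    rintro ⟨h0, h1, h2'', h3, -⟩
    apply he0
    ext i
    fin_cases i <;> assumption
  -- the class of `𝔅 = (b, v)` has order `4`
  set I : Ideal (𝓞 L) := Ideal.span {b, v} with hI
  have hI0 : I ≠ ⊥ := fun h => hb (by
    have : b ∈ I := Ideal.subset_span (by simp)
    rw [h, Submodule.mem_bot] at this; exact this)
  have hImem : I ∈ (Ideal (𝓞 L))⁰ := mem_nonZeroDivisors_iff_ne_zero.mpr hI0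
  set c := ClassGroup.mk0 ⟨I, hImem⟩ with hc
  have hJmem : Ideal.span {w, b ^ 2} ∈ (Ideal (𝓞 L))⁰ := by
    rw [← hI2]; exact pow_mem hImem 2
  have hc2 : c ^ 2 = ClassGroup.mk0 ⟨Ideal.span {w, b ^ 2}, hJmem⟩ := by
    rw [hc, ← map_pow]; congr 1; exact Subtype.ext (by simp [hI2])
  have hc2ne : c ^ 2 ≠ 1 := by
    rw [hc2, Ne, ClassGroup.mk0_eq_one_iff]; exact hJ
  have hwmem : Ideal.span {w} ∈ (Ideal (𝓞 L))⁰ := by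
    rw [← hI4]; exact pow_mem hJmem 2
  have hc4 : c ^ 4 = 1 := by
    have : c ^ 4 = (c ^ 2) ^ 2 := by rw [← pow_mul]
    rw [this, hc2, ← map_pow]
    have heq : (⟨Ideal.span {w, b ^ 2}, hJmem⟩ : (Ideal (𝓞 L))⁰) ^ 2 = ⟨Ideal.span {w}, hwmem⟩ :=
      Subtype.ext (by simp [hI4])
    rw [heq, ClassGroup.mk0_eq_one_iff]
    exact ⟨⟨w, by rw [Ideal.submodule_span_eq]⟩⟩
  have horder : orderOf c = 4 := by
    have := orderOf_eq_prime_pow (p := 2) (n := 1) (x := c) (by rw [pow_one]; exact hc2ne) (by norm_num; exact hc4)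
    rw [this]; norm_num
  rw [← horder]
  exact orderOf_dvd_natCard c

/-- ★★ **`2 ≤ ord₂ h_L`** under the order-four certificate. [cite: NeukirchANT1999, Ch. I §7 Thm. (7.4), Ch. I §3] -/
theorem two_le_padicValNat_card_classGroup_of_orderFourCert (h2 : Module.finrank K L = 2) {s : L} (hs : s ^ 2 = 2)
    (hsK : ∀ k : K, algebraMap K L k ≠ s) (hreal : 0 < NumberField.InfinitePlace.nrRealPlaces K)
    (hK : Fintype.card (InfinitePlace K) ≤ 2)
    (u₁ u₂ u₃ : (𝓞 L)ˣ) {a₁ b₁ a₂ b₂ a₃ b₃ A B : 𝓞 K} {w b v : 𝓞 L}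
    (hu₁ : (((u₁ : 𝓞 L)) : L) = algebraMap K L (a₁ : K) + algebraMap K L (b₁ : K) * s)
    (hu₂ : (((u₂ : 𝓞 L)) : L) = algebraMap K L (a₂ : K) + algebraMap K L (b₂ : K) * s)
    (hu₃ : (((u₃ : 𝓞 L)) : L) = algebraMap K L (a₃ : K) + algebraMap K L (b₃ : K) * s)
    (hw : ((w : 𝓞 L) : L) = algebraMap K L (A : K) + algebraMap K L (B : K) * s) (hb : b ≠ 0)
    (hI2 : (Ideal.span {b, v}) ^ 2 = Ideal.span {w, b ^ 2}) (hI4 : (Ideal.span {w, b ^ 2}) ^ 2 = Ideal.span {w})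
    (hcert : ∀ (e₁ e₂ e₃ e₄ : ℕ) (σ : ℤˣ), e₁ ≤ 1 → e₂ ≤ 1 → e₃ ≤ 1 → e₄ ≤ 1 →
      ¬ (e₁ = 0 ∧ e₂ = 0 ∧ e₃ = 0 ∧ e₄ = 0 ∧ σ = 1) →
      ∃ (q : ℕ) (ψ : 𝓞 K →+* ZMod q) (t : ZMod q) (ρ : 𝓞 K), 2 * t = 1 ∧ ψ ρ ^ 2 = 2 ∧
        ¬ IsSquare (((σ : ℤ) : ZMod q) * (ψ a₁ + ψ b₁ * ψ ρ) ^ e₁ * (ψ a₂ + ψ b₂ * ψ ρ) ^ e₂ *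
          (ψ a₃ + ψ b₃ * ψ ρ) ^ e₃ * (ψ A + ψ B * ψ ρ) ^ e₄)) :
    2 ≤ padicValNat 2 (Nat.card (ClassGroup (𝓞 L))) := by
  haveI : Fact (Nat.Prime 2) := ⟨Nat.prime_two⟩
  have h4 := four_dvd_card_classGroup_of_orderFourCert h2 hs hsK hreal hK u₁ u₂ u₃ hu₁ hu₂ hu₃ hw hb hI2 hI4 hcert
  have hpos : Nat.card (ClassGroup (𝓞 L)) ≠ 0 := Nat.card_pos.ne'
  rw [show (4 : ℕ) = 2 ^ 2 by norm_num] at h4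
  exact (padicValNat_dvd_iff_le hpos).mp h4

end Main

end Literature.NumberTheory.NumberFields

end
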